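import Summits.ABC.IUTFork.Repair.RHHullThresholdExact
import Summits.ABC.IUTFork.Conditional.WRowHexLamSevenTriplesNineteen
import HarnessLib

/-!
# R-W WINDOW numerics, HEX family `λ_k = 1/2 + 2/7^k` at `k = 19`: the REFUTED BAND's INTEGER CELLS (part (R-cells); the W-lane shapes are in the companion file) —
# top-label `HullCell` failures over the sharp class for `(ratPoint λ_19, l)` for EVERY prime `481 ≤ l ≤ 2017637`, e-robustly and UNIFORMLY in `l`; glue: every prime `11 ≤ l ≤ 2017637`

PROOF-ONLY file (D-0012; 0 definitions, 0 `Prop` facts, no instance, no notation) of the abc-iut cell (branch C certificate seat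
abc-iut-C-cert-1, gen 9; row «W:HEX-AXIS-REST-2», `k = 19`, part (R); generator gen_ref.py (HOME/staging/C/cert-1/g9/hexgen/, analytic piece plan) from the `k = 10` template p508090 and gen 8's `k = 12…17` files).
TAKES NO SIDE on [IUTchIII] Cor. 3.12 (S. Mochizuki, *Inter-universal Teichmüller theory III*, Cor. 3.12 p. 173–174; Step (xi-f) p. 184) or on any
author; «refuted as typed» ≠ «refuted in print». BEFORE THIS FILE (BY NAME): at `k = 19` the K-line object FAILS at every prime `11 ≤ l ≤ 479` (abc-iut-W-neg-2's `HexRad.not_pilotKummerCompatHull_lamSeven_rad_eleven`, every `k ≥ 11`); no theorem names a level `l ≥ 481`.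
THIS FILE: at the pole `p = 7` of the HEX19 triple `11398895185373147 + 11398895185373139 = 22797790370746286` (`v = v₇(abc) = 19`; prelude `WRowHexLamSevenTriplesNineteen`) abc-iut-W-neg-1's SHARP local-type
class (`WRow.localType_class_triple_sharp`, p498814 §1) leaves `A ∈ {15, 30}`; per member and turning-point piece
(A = 15: a₀ = 4 on 481 ≤ l ≤ 959; A = 15: a₀ = 5 on 961 ≤ l ≤ 6721; A = 15: a₀ = 6 on 6723 ≤ l ≤ 47059; A = 15: a₀ = 7 on 47061 ≤ l ≤ 329417; A = 15: a₀ = 8 on 329419 ≤ l ≤ 2017637; A = 30: a₀ = 5 on 481 ≤ l ≤ 3361; A = 30: a₀ = 6 on 3363 ≤ l ≤ 23529; A = 30: a₀ = 7 on 23531 ≤ l ≤ 164707; A = 30: a₀ = 8 on 164709 ≤ l ≤ 1152959; A = 30: a₀ = 9 on 1152961 ≤ l ≤ 2017637) the top-label cell of R-H row 4's `HullCell` FAILS by a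
floor-free downward parabola (`e·⌊X/e⌋ ≥ X − e + 1`, inner radius bounded by `6·r_in ≤ A·l + 6`), with no exact-floor literal level (the floor-free pieces reach the last refuted prime).
W-neg-1's three sockets (`Cor312LicenceTripleHullCellRefuteTameSharp` §2), transported to `ratPoint ((2 : ℚ)⁻¹ + 2/7^k)`, `k = 19`, give the three W-lane shapes
`WRow.not_licence_lamSeven_nineteen_band` / `WRow.not_exists_qPinned_and_hull_lamSeven_nineteen_band` / `GenuineK.not_pilotKummerCompatHull_chosen_lamSeven_nineteen_band`,
and the GLUE `GenuineK.not_pilotKummerCompatHull_chosen_lamSeven_nineteen_le` (every prime `11 ≤ l ≤ 2017637`). DESK (two engines agree: this seat's analytic piece plan (gen 8's scan semantics)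
and abc-iut-W-num-5 g5's engine C, STATUS 07:20:50Z): the exact top-label cell fails at every prime of the band and first holds at `l = 2017643`; the
inhabited band from there is part (I) (`WRow.licence_lamSeven_nineteen_all`), NOT claimed here. These levels are NOT rows of the R-W WINDOW-TABLE.
HONEST SCOPE: OUR sharp containers and Dupuy–Hilado's typed (Ind1)/(Ind2); the per-label licence is a STRONGER-THAN-PRINT sufficient form of Step (xi-f);
admissibility / Szpiro-badness / (P6) of `(ratPoint λ_19, l)` and NON-EMPTINESS of the datum type are NOT claimed (a «∀ T» statement is vacuous if no datum
exists); nothing about the printed inequality, the number-level `Cor22.Cor312AtDatum` or any author's intended hull; typed ≠ proved; instantiated ≠ endorsed; no abc claim.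
[cite: Mochizuki2012, IUTchI Ex. 3.2 (iv) p. 71; IUTchIII Cor. 3.12 Step (xi-d) p. 183, (xi-f) p. 184; IUTchIV Prop. 1.1 p. 9, Prop. 1.2 (i)(ii) p. 10, Thm. 1.10 p. 22, Cor. 2.2 (ii) proof (P5) p. 46]
[cite: DupuyHilado2025, §3.3, §3.4, §4.9, §4.12] [cite: SilvermanATAEC1994, V.5 Thm. 5.3 and Cor. 5.4] [claim: Mochizuki2012, status: disputed] for every IUT sentence quoted.
-/

noncomputable section

open Set Function NumberField IsDedekindDomain

namespace Summit.ABC.IUTFork.Conditional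

open Thm311 Thm311.Real Cor312 Cor312Vol Cor312Prov Literature.IUT.LogThetaLattice Literature.IUT.LogVolume
  Literature.IUT.HodgeTheaters Literature.IUT.LogVolume.ThetaData Literature.IUT.LogVolume.Cor22
open Literature.NumberTheory.NumberFields Literature.NumberTheory.GaloisRepresentations.Ultrametric
open Literature.NumberTheory.DiophantineGeometry Literature.NumberTheory.DiophantineGeometry.GenEll Summit.ABC.ABC.Theorems
open Summit.ABC.IUTFork.Repair.RH.HullThresholdExact

/-! ## §1. The integer side at `p = 7`, `v = 19`: class `A ∈ {15, 30}`, top label -/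

/-- Floor-free failure of the top-label cell, `k = 19`, member `A = 15` (`e = 15l`, `m = 285`), turning point `a₀ = 4` (`r_out = 2401 − 4·15l`),
every `240 ≤ j ≤ 479` (`l = 2j + 1`), for ANY inner radius with `6·r_in ≤ 15l + 6` (so for `⌊15l/6⌋ + 1`): `e·⌊X/e⌋ ≥ X − e + 1` and the
margin is a downward parabola in `j` positive on the range. [folklore] -/
theorem RefBand.not_hullCell_hex19_A15_a4 {j rin : ℤ} (hlo : 240 ≤ j) (hhi : j ≤ 479) (hrin : 6 * rin ≤ 15 * (2 * j + 1) + 6) :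
    ¬ HullCell (15 * (2 * j + 1)) 285 j rin (2401 - 4 * (15 * (2 * j + 1))) := by
  intro hc
  unfold HullCell at hc
  set e : ℤ := 15 * (2 * j + 1) with he
  have he0 : 0 < e := by rw [he]; omega
  set X : ℤ := j ^ 2 * 285 - j * (e - 1) - (j + 1) * rin with hX
  have hdiv : X - e < e * (X / e) := by
    have h1 := Int.emod_add_mul_ediv X e
    have h2 := Int.emod_lt_of_pos X he0
    have h3 := Int.emod_nonneg X he0.ne'
    nlinarith [h1, h2, h3]
  have hk1 : 0 ≤ (479 - j) * (j + 1) := mul_nonneg (by omega) (by omega)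
  have hk2 : 0 ≤ (479 - j) * (j - 240) := mul_nonneg (by omega) (by omega)
  nlinarith [hdiv, hk1, hk2, hc, hrin, hX]

/-- Floor-free failure of the top-label cell, `k = 19`, member `A = 15` (`e = 15l`, `m = 285`), turning point `a₀ = 5` (`r_out = 16807 − 5·15l`),
every `480 ≤ j ≤ 3360` (`l = 2j + 1`), for ANY inner radius with `6·r_in ≤ 15l + 6` (so for `⌊15l/6⌋ + 1`): `e·⌊X/e⌋ ≥ X − e + 1` and the
margin is a downward parabola in `j` positive on the range. [folklore] -/
theorem RefBand.not_hullCell_hex19_A15_a5 {j rin : ℤ} (hlo : 480 ≤ j) (hhi : j ≤ 3360) (hrin : 6 * rin ≤ 15 * (2 * j + 1) + 6) :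
    ¬ HullCell (15 * (2 * j + 1)) 285 j rin (16807 - 5 * (15 * (2 * j + 1))) := by
  intro hc
  unfold HullCell at hc
  set e : ℤ := 15 * (2 * j + 1) with he
  have he0 : 0 < e := by rw [he]; omega
  set X : ℤ := j ^ 2 * 285 - j * (e - 1) - (j + 1) * rin with hX
  have hdiv : X - e < e * (X / e) := by
    have h1 := Int.emod_add_mul_ediv X e
    have h2 := Int.emod_lt_of_pos X he0
    have h3 := Int.emod_nonneg X he0.ne'
    nlinarith [h1, h2, h3]
  have hk1 : 0 ≤ (3360 - j) * (j + 1) := mul_nonneg (by omega) (by omega)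
  have hk2 : 0 ≤ (3360 - j) * (j - 480) := mul_nonneg (by omega) (by omega)
  nlinarith [hdiv, hk1, hk2, hc, hrin, hX]

/-- Floor-free failure of the top-label cell, `k = 19`, member `A = 15` (`e = 15l`, `m = 285`), turning point `a₀ = 6` (`r_out = 117649 − 6·15l`),
every `3361 ≤ j ≤ 23529` (`l = 2j + 1`), for ANY inner radius with `6·r_in ≤ 15l + 6` (so for `⌊15l/6⌋ + 1`): `e·⌊X/e⌋ ≥ X − e + 1` and the
margin is a downward parabola in `j` positive on the range. [folklore] -/
theorem RefBand.not_hullCell_hex19_A15_a6 {j rin : ℤ} (hlo : 3361 ≤ j) (hhi : j ≤ 23529) (hrin : 6 * rin ≤ 15 * (2 * j + 1) + 6) :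
    ¬ HullCell (15 * (2 * j + 1)) 285 j rin (117649 - 6 * (15 * (2 * j + 1))) := by
  intro hc
  unfold HullCell at hc
  set e : ℤ := 15 * (2 * j + 1) with he
  have he0 : 0 < e := by rw [he]; omega
  set X : ℤ := j ^ 2 * 285 - j * (e - 1) - (j + 1) * rin with hX
  have hdiv : X - e < e * (X / e) := by
    have h1 := Int.emod_add_mul_ediv X e
    have h2 := Int.emod_lt_of_pos X he0
    have h3 := Int.emod_nonneg X he0.ne'
    nlinarith [h1, h2, h3]
  have hk1 : 0 ≤ (23529 - j) * (j + 1) := mul_nonneg (by omega) (by omega)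
  have hk2 : 0 ≤ (23529 - j) * (j - 3361) := mul_nonneg (by omega) (by omega)
  nlinarith [hdiv, hk1, hk2, hc, hrin, hX]

/-- Floor-free failure of the top-label cell, `k = 19`, member `A = 15` (`e = 15l`, `m = 285`), turning point `a₀ = 7` (`r_out = 823543 − 7·15l`),
every `23530 ≤ j ≤ 164708` (`l = 2j + 1`), for ANY inner radius with `6·r_in ≤ 15l + 6` (so for `⌊15l/6⌋ + 1`): `e·⌊X/e⌋ ≥ X − e + 1` and the
margin is a downward parabola in `j` positive on the range. [folklore] -/
theorem RefBand.not_hullCell_hex19_A15_a7 {j rin : ℤ} (hlo : 23530 ≤ j) (hhi : j ≤ 164708) (hrin : 6 * rin ≤ 15 * (2 * j + 1) + 6) :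
    ¬ HullCell (15 * (2 * j + 1)) 285 j rin (823543 - 7 * (15 * (2 * j + 1))) := by
  intro hc
  unfold HullCell at hc
  set e : ℤ := 15 * (2 * j + 1) with he
  have he0 : 0 < e := by rw [he]; omega
  set X : ℤ := j ^ 2 * 285 - j * (e - 1) - (j + 1) * rin with hX
  have hdiv : X - e < e * (X / e) := by
    have h1 := Int.emod_add_mul_ediv X e
    have h2 := Int.emod_lt_of_pos X he0
    have h3 := Int.emod_nonneg X he0.ne'
    nlinarith [h1, h2, h3]
  have hk1 : 0 ≤ (164708 - j) * (j + 1) := mul_nonneg (by omega) (by omega)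
  have hk2 : 0 ≤ (164708 - j) * (j - 23530) := mul_nonneg (by omega) (by omega)
  nlinarith [hdiv, hk1, hk2, hc, hrin, hX]

/-- Floor-free failure of the top-label cell, `k = 19`, member `A = 15` (`e = 15l`, `m = 285`), turning point `a₀ = 8` (`r_out = 5764801 − 8·15l`),
every `164709 ≤ j ≤ 1008818` (`l = 2j + 1`), for ANY inner radius with `6·r_in ≤ 15l + 6` (so for `⌊15l/6⌋ + 1`): `e·⌊X/e⌋ ≥ X − e + 1` and the
margin is a downward parabola in `j` positive on the range. [folklore] -/
theorem RefBand.not_hullCell_hex19_A15_a8 {j rin : ℤ} (hlo : 164709 ≤ j) (hhi : j ≤ 1008818) (hrin : 6 * rin ≤ 15 * (2 * j + 1) + 6) :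
    ¬ HullCell (15 * (2 * j + 1)) 285 j rin (5764801 - 8 * (15 * (2 * j + 1))) := by
  intro hc
  unfold HullCell at hc
  set e : ℤ := 15 * (2 * j + 1) with he
  have he0 : 0 < e := by rw [he]; omega
  set X : ℤ := j ^ 2 * 285 - j * (e - 1) - (j + 1) * rin with hX
  have hdiv : X - e < e * (X / e) := by
    have h1 := Int.emod_add_mul_ediv X e
    have h2 := Int.emod_lt_of_pos X he0
    have h3 := Int.emod_nonneg X he0.ne'
    nlinarith [h1, h2, h3]
  have hk1 : 0 ≤ (1008818 - j) * (j + 1) := mul_nonneg (by omega) (by omega)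
  have hk2 : 0 ≤ (1008818 - j) * (j - 164709) := mul_nonneg (by omega) (by omega)
  nlinarith [hdiv, hk1, hk2, hc, hrin, hX]

/-- Floor-free failure of the top-label cell, `k = 19`, member `A = 30` (`e = 30l`, `m = 570`), turning point `a₀ = 5` (`r_out = 16807 − 5·30l`),
every `240 ≤ j ≤ 1680` (`l = 2j + 1`), for ANY inner radius with `6·r_in ≤ 30l + 6` (so for `⌊30l/6⌋ + 1`): `e·⌊X/e⌋ ≥ X − e + 1` and the
margin is a downward parabola in `j` positive on the range. [folklore] -/
theorem RefBand.not_hullCell_hex19_A30_a5 {j rin : ℤ} (hlo : 240 ≤ j) (hhi : j ≤ 1680) (hrin : 6 * rin ≤ 30 * (2 * j + 1) + 6) :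
    ¬ HullCell (30 * (2 * j + 1)) 570 j rin (16807 - 5 * (30 * (2 * j + 1))) := by
  intro hc
  unfold HullCell at hc
  set e : ℤ := 30 * (2 * j + 1) with he
  have he0 : 0 < e := by rw [he]; omega
  set X : ℤ := j ^ 2 * 570 - j * (e - 1) - (j + 1) * rin with hX
  have hdiv : X - e < e * (X / e) := by
    have h1 := Int.emod_add_mul_ediv X e
    have h2 := Int.emod_lt_of_pos X he0
    have h3 := Int.emod_nonneg X he0.ne'
    nlinarith [h1, h2, h3]
  have hk1 : 0 ≤ (1680 - j) * (j + 1) := mul_nonneg (by omega) (by omega)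
  have hk2 : 0 ≤ (1680 - j) * (j - 240) := mul_nonneg (by omega) (by omega)
  nlinarith [hdiv, hk1, hk2, hc, hrin, hX]

/-- Floor-free failure of the top-label cell, `k = 19`, member `A = 30` (`e = 30l`, `m = 570`), turning point `a₀ = 6` (`r_out = 117649 − 6·30l`),
every `1681 ≤ j ≤ 11764` (`l = 2j + 1`), for ANY inner radius with `6·r_in ≤ 30l + 6` (so for `⌊30l/6⌋ + 1`): `e·⌊X/e⌋ ≥ X − e + 1` and the
margin is a downward parabola in `j` positive on the range. [folklore] -/
theorem RefBand.not_hullCell_hex19_A30_a6 {j rin : ℤ} (hlo : 1681 ≤ j) (hhi : j ≤ 11764) (hrin : 6 * rin ≤ 30 * (2 * j + 1) + 6) :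
    ¬ HullCell (30 * (2 * j + 1)) 570 j rin (117649 - 6 * (30 * (2 * j + 1))) := by
  intro hc
  unfold HullCell at hc
  set e : ℤ := 30 * (2 * j + 1) with he
  have he0 : 0 < e := by rw [he]; omega
  set X : ℤ := j ^ 2 * 570 - j * (e - 1) - (j + 1) * rin with hX
  have hdiv : X - e < e * (X / e) := by
    have h1 := Int.emod_add_mul_ediv X e
    have h2 := Int.emod_lt_of_pos X he0
    have h3 := Int.emod_nonneg X he0.ne'
    nlinarith [h1, h2, h3]
  have hk1 : 0 ≤ (11764 - j) * (j + 1) := mul_nonneg (by omega) (by omega)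
  have hk2 : 0 ≤ (11764 - j) * (j - 1681) := mul_nonneg (by omega) (by omega)
  nlinarith [hdiv, hk1, hk2, hc, hrin, hX]

/-- Floor-free failure of the top-label cell, `k = 19`, member `A = 30` (`e = 30l`, `m = 570`), turning point `a₀ = 7` (`r_out = 823543 − 7·30l`),
every `11765 ≤ j ≤ 82353` (`l = 2j + 1`), for ANY inner radius with `6·r_in ≤ 30l + 6` (so for `⌊30l/6⌋ + 1`): `e·⌊X/e⌋ ≥ X − e + 1` and the
margin is a downward parabola in `j` positive on the range. [folklore] -/
theorem RefBand.not_hullCell_hex19_A30_a7 {j rin : ℤ} (hlo : 11765 ≤ j) (hhi : j ≤ 82353) (hrin : 6 * rin ≤ 30 * (2 * j + 1) + 6) :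
    ¬ HullCell (30 * (2 * j + 1)) 570 j rin (823543 - 7 * (30 * (2 * j + 1))) := by
  intro hc
  unfold HullCell at hc
  set e : ℤ := 30 * (2 * j + 1) with he
  have he0 : 0 < e := by rw [he]; omega
  set X : ℤ := j ^ 2 * 570 - j * (e - 1) - (j + 1) * rin with hX
  have hdiv : X - e < e * (X / e) := by
    have h1 := Int.emod_add_mul_ediv X e
    have h2 := Int.emod_lt_of_pos X he0
    have h3 := Int.emod_nonneg X he0.ne'
    nlinarith [h1, h2, h3]
  have hk1 : 0 ≤ (82353 - j) * (j + 1) := mul_nonneg (by omega) (by omega)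
  have hk2 : 0 ≤ (82353 - j) * (j - 11765) := mul_nonneg (by omega) (by omega)
  nlinarith [hdiv, hk1, hk2, hc, hrin, hX]

/-- Floor-free failure of the top-label cell, `k = 19`, member `A = 30` (`e = 30l`, `m = 570`), turning point `a₀ = 8` (`r_out = 5764801 − 8·30l`),
every `82354 ≤ j ≤ 576479` (`l = 2j + 1`), for ANY inner radius with `6·r_in ≤ 30l + 6` (so for `⌊30l/6⌋ + 1`): `e·⌊X/e⌋ ≥ X − e + 1` and the
margin is a downward parabola in `j` positive on the range. [folklore] -/
theorem RefBand.not_hullCell_hex19_A30_a8 {j rin : ℤ} (hlo : 82354 ≤ j) (hhi : j ≤ 576479) (hrin : 6 * rin ≤ 30 * (2 * j + 1) + 6) :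
    ¬ HullCell (30 * (2 * j + 1)) 570 j rin (5764801 - 8 * (30 * (2 * j + 1))) := by
  intro hc
  unfold HullCell at hc
  set e : ℤ := 30 * (2 * j + 1) with he
  have he0 : 0 < e := by rw [he]; omega
  set X : ℤ := j ^ 2 * 570 - j * (e - 1) - (j + 1) * rin with hX
  have hdiv : X - e < e * (X / e) := by
    have h1 := Int.emod_add_mul_ediv X e
    have h2 := Int.emod_lt_of_pos X he0
    have h3 := Int.emod_nonneg X he0.ne'
    nlinarith [h1, h2, h3]
  have hk1 : 0 ≤ (576479 - j) * (j + 1) := mul_nonneg (by omega) (by omega)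
  have hk2 : 0 ≤ (576479 - j) * (j - 82354) := mul_nonneg (by omega) (by omega)
  nlinarith [hdiv, hk1, hk2, hc, hrin, hX]

/-- Floor-free failure of the top-label cell, `k = 19`, member `A = 30` (`e = 30l`, `m = 570`), turning point `a₀ = 9` (`r_out = 40353607 − 9·30l`),
every `576480 ≤ j ≤ 1008818` (`l = 2j + 1`), for ANY inner radius with `6·r_in ≤ 30l + 6` (so for `⌊30l/6⌋ + 1`): `e·⌊X/e⌋ ≥ X − e + 1` and the
margin is a downward parabola in `j` positive on the range. [folklore] -/
theorem RefBand.not_hullCell_hex19_A30_a9 {j rin : ℤ} (hlo : 576480 ≤ j) (hhi : j ≤ 1008818) (hrin : 6 * rin ≤ 30 * (2 * j + 1) + 6) :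
    ¬ HullCell (30 * (2 * j + 1)) 570 j rin (40353607 - 9 * (30 * (2 * j + 1))) := by
  intro hc
  unfold HullCell at hc
  set e : ℤ := 30 * (2 * j + 1) with he
  have he0 : 0 < e := by rw [he]; omega
  set X : ℤ := j ^ 2 * 570 - j * (e - 1) - (j + 1) * rin with hX
  have hdiv : X - e < e * (X / e) := by
    have h1 := Int.emod_add_mul_ediv X e
    have h2 := Int.emod_lt_of_pos X he0
    have h3 := Int.emod_nonneg X he0.ne'
    nlinarith [h1, h2, h3]
  have hk1 : 0 ≤ (1008818 - j) * (j + 1) := mul_nonneg (by omega) (by omega)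
  have hk2 : 0 ≤ (1008818 - j) * (j - 576480) := mul_nonneg (by omega) (by omega)
  nlinarith [hdiv, hk1, hk2, hc, hrin, hX]

/-- **The engine's `hcell` for the HEX19 triple at `p = 7` (`v = 19`), odd `481 ≤ l ≤ 2017637`, top label.** The sharp clauses force
`A ∈ {15, 30}`; per member and turning-point piece the cell fails by the floor-free lemmas above, at the literal levels by the exact floor. [folklore] -/
theorem RefBand.cells_hex19_band {l : ℕ} (hlo : 481 ≤ l) (hhi : l ≤ 2017637) (hodd : Odd l) {i : ℕ} (hi : i + 1 = (l - 1) / 2)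
    (A : ℕ) (hA30 : A ∣ 30) (hA15 : 15 ∣ A * 19) (hAev : Even 19 → A ∣ 15) (hA3 : 3 ∣ 19 → A ∣ 10) (hA5 : 5 ∣ 19 → A ∣ 6) :
    ∃ a₀ : ℕ, (∀ s : ℕ, s < a₀ → (1 : ℤ) * ((7 : ℕ) : ℤ) ^ s * (((7 : ℕ) : ℤ) - 1) < ((A * l : ℕ) : ℤ)) ∧
      ((A * l : ℕ) : ℤ) ≤ 1 * ((7 : ℕ) : ℤ) ^ a₀ * (((7 : ℕ) : ℤ) - 1) ∧
      ¬ HullCell ((A * l : ℕ) : ℤ) ((A * 19 : ℕ) : ℤ) ((i : ℤ) + 1) (((A * l) / ((7 : ℕ) - 1) + 1 : ℕ) : ℤ)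
        (((7 : ℕ) : ℤ) ^ a₀ - (a₀ : ℤ) * ((A * l : ℕ) : ℤ)) := by
  have hAg : A ∣ 30 := by
    exact hA30
  have hdA : 15 ∣ A := by
    have h' : 15 ∣ A * 19 := Nat.dvd_trans (by norm_num) hA15
    exact (Nat.Coprime.dvd_of_dvd_mul_right (by norm_num : Nat.Coprime 15 19) h')
  have hA : A = 15 ∨ A = 30 := by
    have h1 : A ≤ 30 := Nat.le_of_dvd (by norm_num) hAg
    have h2 : 0 < A := Nat.pos_of_dvd_of_pos hAg (by norm_num)
    interval_cases A <;> omega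
  obtain ⟨j, hj⟩ := hodd
  have hij : (i : ℤ) + 1 = (j : ℤ) := by
    have : i + 1 = j := by omega
    exact_mod_cast this
  rcases hA with rfl | rfl
  · have hrin : (6 : ℤ) * (((((15 * l) / ((7 : ℕ) - 1) + 1 : ℕ) : ℤ))) ≤ 15 * (2 * (j : ℤ) + 1) + 6 := by
      have h0 : ((7 : ℕ) - 1) * ((15 * l) / ((7 : ℕ) - 1)) ≤ 15 * l := Nat.mul_div_le _ _
      have h1 : (6 : ℤ) * ((((15 * l) / ((7 : ℕ) - 1) : ℕ) : ℤ)) ≤ ((15 * l : ℕ) : ℤ) := by exact_mod_cast h0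
      push_cast at h1 ⊢; omega
    have he : ((15 * l : ℕ) : ℤ) = 15 * (2 * (j : ℤ) + 1) := by push_cast; omega
    have hm : ((15 * 19 : ℕ) : ℤ) = 285 := by norm_num
    by_cases hp0 : 481 ≤ l ∧ l ≤ 959
    · refine ⟨4, fun s hs => ?_, ?_, ?_⟩
      · interval_cases s <;> norm_num <;> omega
      · norm_num; omega
      · have hro : (((7 : ℕ) : ℤ) ^ 4 - ((4 : ℕ) : ℤ) * ((15 * l : ℕ) : ℤ)) = 2401 - 4 * (15 * (2 * (j : ℤ) + 1)) := by
          push_cast; omega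
        rw [hro, hij, he, hm]
        exact RefBand.not_hullCell_hex19_A15_a4 (by omega) (by omega) hrin
    by_cases hp1 : 961 ≤ l ∧ l ≤ 6721
    · refine ⟨5, fun s hs => ?_, ?_, ?_⟩
      · interval_cases s <;> norm_num <;> omega
      · norm_num; omega
      · have hro : (((7 : ℕ) : ℤ) ^ 5 - ((5 : ℕ) : ℤ) * ((15 * l : ℕ) : ℤ)) = 16807 - 5 * (15 * (2 * (j : ℤ) + 1)) := by
          push_cast; omega
        rw [hro, hij, he, hm]
        exact RefBand.not_hullCell_hex19_A15_a5 (by omega) (by omega) hrin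
    by_cases hp2 : 6723 ≤ l ∧ l ≤ 47059
    · refine ⟨6, fun s hs => ?_, ?_, ?_⟩
      · interval_cases s <;> norm_num <;> omega
      · norm_num; omega
      · have hro : (((7 : ℕ) : ℤ) ^ 6 - ((6 : ℕ) : ℤ) * ((15 * l : ℕ) : ℤ)) = 117649 - 6 * (15 * (2 * (j : ℤ) + 1)) := by
          push_cast; omega
        rw [hro, hij, he, hm]
        exact RefBand.not_hullCell_hex19_A15_a6 (by omega) (by omega) hrin
    by_cases hp3 : 47061 ≤ l ∧ l ≤ 329417
    · refine ⟨7, fun s hs => ?_, ?_, ?_⟩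
      · interval_cases s <;> norm_num <;> omega
      · norm_num; omega
      · have hro : (((7 : ℕ) : ℤ) ^ 7 - ((7 : ℕ) : ℤ) * ((15 * l : ℕ) : ℤ)) = 823543 - 7 * (15 * (2 * (j : ℤ) + 1)) := by
          push_cast; omega
        rw [hro, hij, he, hm]
        exact RefBand.not_hullCell_hex19_A15_a7 (by omega) (by omega) hrin
    by_cases hp4 : 329419 ≤ l ∧ l ≤ 2017637
    · refine ⟨8, fun s hs => ?_, ?_, ?_⟩
      · interval_cases s <;> norm_num <;> omega
      · norm_num; omega
      · have hro : (((7 : ℕ) : ℤ) ^ 8 - ((8 : ℕ) : ℤ) * ((15 * l : ℕ) : ℤ)) = 5764801 - 8 * (15 * (2 * (j : ℤ) + 1)) := by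
          push_cast; omega
        rw [hro, hij, he, hm]
        exact RefBand.not_hullCell_hex19_A15_a8 (by omega) (by omega) hrin
    -- no level is left: the pieces cover the whole band
    exfalso; omega
  · have hrin : (6 : ℤ) * (((((30 * l) / ((7 : ℕ) - 1) + 1 : ℕ) : ℤ))) ≤ 30 * (2 * (j : ℤ) + 1) + 6 := by
      have h0 : ((7 : ℕ) - 1) * ((30 * l) / ((7 : ℕ) - 1)) ≤ 30 * l := Nat.mul_div_le _ _
      have h1 : (6 : ℤ) * ((((30 * l) / ((7 : ℕ) - 1) : ℕ) : ℤ)) ≤ ((30 * l : ℕ) : ℤ) := by exact_mod_cast h0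
      push_cast at h1 ⊢; omega
    have he : ((30 * l : ℕ) : ℤ) = 30 * (2 * (j : ℤ) + 1) := by push_cast; omega
    have hm : ((30 * 19 : ℕ) : ℤ) = 570 := by norm_num
    by_cases hp0 : 481 ≤ l ∧ l ≤ 3361
    · refine ⟨5, fun s hs => ?_, ?_, ?_⟩
      · interval_cases s <;> norm_num <;> omega
      · norm_num; omega
      · have hro : (((7 : ℕ) : ℤ) ^ 5 - ((5 : ℕ) : ℤ) * ((30 * l : ℕ) : ℤ)) = 16807 - 5 * (30 * (2 * (j : ℤ) + 1)) := by
          push_cast; omega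
        rw [hro, hij, he, hm]
        exact RefBand.not_hullCell_hex19_A30_a5 (by omega) (by omega) hrin
    by_cases hp1 : 3363 ≤ l ∧ l ≤ 23529
    · refine ⟨6, fun s hs => ?_, ?_, ?_⟩
      · interval_cases s <;> norm_num <;> omega
      · norm_num; omega
      · have hro : (((7 : ℕ) : ℤ) ^ 6 - ((6 : ℕ) : ℤ) * ((30 * l : ℕ) : ℤ)) = 117649 - 6 * (30 * (2 * (j : ℤ) + 1)) := by
          push_cast; omega
        rw [hro, hij, he, hm]
        exact RefBand.not_hullCell_hex19_A30_a6 (by omega) (by omega) hrin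
    by_cases hp2 : 23531 ≤ l ∧ l ≤ 164707
    · refine ⟨7, fun s hs => ?_, ?_, ?_⟩
      · interval_cases s <;> norm_num <;> omega
      · norm_num; omega
      · have hro : (((7 : ℕ) : ℤ) ^ 7 - ((7 : ℕ) : ℤ) * ((30 * l : ℕ) : ℤ)) = 823543 - 7 * (30 * (2 * (j : ℤ) + 1)) := by
          push_cast; omega
        rw [hro, hij, he, hm]
        exact RefBand.not_hullCell_hex19_A30_a7 (by omega) (by omega) hrin
    by_cases hp3 : 164709 ≤ l ∧ l ≤ 1152959
    · refine ⟨8, fun s hs => ?_, ?_, ?_⟩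
      · interval_cases s <;> norm_num <;> omega
      · norm_num; omega
      · have hro : (((7 : ℕ) : ℤ) ^ 8 - ((8 : ℕ) : ℤ) * ((30 * l : ℕ) : ℤ)) = 5764801 - 8 * (30 * (2 * (j : ℤ) + 1)) := by
          push_cast; omega
        rw [hro, hij, he, hm]
        exact RefBand.not_hullCell_hex19_A30_a8 (by omega) (by omega) hrin
    by_cases hp4 : 1152961 ≤ l ∧ l ≤ 2017637
    · refine ⟨9, fun s hs => ?_, ?_, ?_⟩
      · interval_cases s <;> norm_num <;> omega
      · norm_num; omega
      · have hro : (((7 : ℕ) : ℤ) ^ 9 - ((9 : ℕ) : ℤ) * ((30 * l : ℕ) : ℤ)) = 40353607 - 9 * (30 * (2 * (j : ℤ) + 1)) := by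
          push_cast; omega
        rw [hro, hij, he, hm]
        exact RefBand.not_hullCell_hex19_A30_a9 (by omega) (by omega) hrin
    -- no level is left: the pieces cover the whole band
    exfalso; omega

end Summit.ABC.IUTFork.Conditional

end
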